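import Summits.Ventures.Crystal3D.Theorems.StickyWulffConstantPolycrystalWulffBoundPolyRefinementOfVolume
import Summits.Ventures.Crystal3D.Theorems.StickyWulffConstantTextureLiminfTexShadowDefs
import Literature.Analysis.Convexity.AnisotropicPerimeterComplement

/-!
# `PolycrystalWulffBound`: the facet formula for a `Poly` grain, from `PolytopeCalculus`

Route `StickyWulffConstant` of the venture `Summits/Ventures/Crystal3D`, crux `PolycrystalWulffBound`
(item `stmt-Ventures-19482`), second prover lane.  COMPOSITION CHECK of the bridge: the registered
stub statement `PolytopeCalculus` of line TexShadow (`stmt-Ventures-19483`; clause (A) landed by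
lit g8, clause (B) being landed by eng g7) is consumed BY NAME, and the turnkey refinement
`exists_disjoint_polytope_refinement_of_volume_lt_top` supplies exactly its hypotheses, so that for
EVERY finite union of open H-polyhedra of finite volume (the P stub's `Poly` grains, no disjointness,
no unit normals, no boundedness assumed) the route's `per K` is a FACET SUM:

* `per_congr_ae` — `per K` does not see null sets;
* `per_poly_eq_facetSums_of_polytopeCalculus` — `PolytopeCalculus →` for `S = ⋃ i, polytope (H i)`
  with `volume S < ⊤` and `K` compact convex `∋ 0`: disjoint cells `Q_j = polytope (H' j)` inside `S`
  with `S =ᵐ ⋃ Q_j`, each `per K Q_j = Σ_{q ∈ H' j} h_K(q.1)·facetArea`, and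
  `per K S = Σ_j per K Q_j − Σ_{j<j'} (h_K(ν)+h_K(−ν))·facetArea(Q̄_j ∩ Q̄_j')`.
Conditional only on the registered stub BY NAME (discharged by `stub_polytopeCalculus` when it lands).
WHAT THIS IS NOT: a proof of `PolytopeCalculus`; nothing on the crux beyond bookkeeping.
-/

noncomputable section

namespace Summit.Ventures.Crystal3D.Theorems

open MeasureTheory Set
open scoped RealInnerProductSpace ENNReal
open Summit.Ventures.Crystal3D.Cruxes.TextureLiminf.TexShadow

/-- `per K` is invariant under null modifications of the set. -/
theorem per_congr_ae (K : Set E3) {A B : Set E3} (h : A =ᵐ[volume] B) : per K A = per K B := by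
  unfold per
  rw [perK_eq_anisotropicPerimeter, perK_eq_anisotropicPerimeter,
    Literature.Analysis.Convexity.anisotropicPerimeter_congr_ae K h]

/-- **Facet formula for a polyhedral (`Poly`) set, from `PolytopeCalculus`.** Assuming the
registered stub statement `PolytopeCalculus` (line TexShadow, item 19483) by name: for every
`H : Fin k → Finset (E3 × ℝ)` whose polyhedral set `S = ⋃ i, polytope (H i)` has finite volume and
every compact convex `K ∋ 0`, there are pairwise disjoint bounded open polytopes
`Q_j = polytope (H' j)` (unit normals, distinct facet planes) with common-plane normals `ν`, all
inside `S`, with `S =ᵐ ⋃ j, Q_j`, such that each `per K Q_j` is its facet sum (clause (A)) and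
`per K S = Σ_j per K Q_j − Σ_{j<j'} (h_K(ν j j') + h_K(−ν j j')) · facetArea (Q̄_j ∩ Q̄_j') (ν j j')`
(clause (B) + null-set invariance). -/
theorem per_poly_eq_facetSums_of_polytopeCalculus (hPC : PolytopeCalculus) {K : Set E3}
    (hK : IsCompact K) (hKc : Convex ℝ K) (h0 : (0 : E3) ∈ K) {k : ℕ}
    (H : Fin k → Finset (E3 × ℝ)) (hv : volume (⋃ i, polytope (H i)) < ⊤) :
    ∃ (k' : ℕ) (H' : Fin k' → Finset (E3 × ℝ)) (ν : Fin k' → Fin k' → E3),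
      (∀ j j', j ≠ j' → Disjoint (polytope (H' j)) (polytope (H' j'))) ∧
      (∀ j, polytope (H' j) ⊆ ⋃ i, polytope (H i)) ∧
      ((⋃ i, polytope (H i)) =ᵐ[volume] ⋃ j, polytope (H' j)) ∧
      (∀ j, per K (polytope (H' j)) = ∑ q ∈ H' j, supportFn K q.1 *
        facetArea (closure (polytope (H' j)) ∩ {x | ⟪q.1, x⟫ = q.2}) q.1) ∧
      per K (⋃ i, polytope (H i)) = ∑ j, per K (polytope (H' j)) -
        ∑ j, ∑ j', (if j < j' then (supportFn K (ν j j') + supportFn K (-ν j j')) *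
          facetArea (closure (polytope (H' j)) ∩ closure (polytope (H' j'))) (ν j j') else 0) := by
  obtain ⟨k', H', ν, hbd, hunit, hdist, hdisj, hplane, hsub, hae⟩ :=
    exists_disjoint_polytope_refinement_of_volume_lt_top (E := E3) H hv
  obtain ⟨hA, hB⟩ := hPC K hK hKc h0
  have hae' : (⋃ i, polytope (H i)) =ᵐ[volume] ⋃ j, polytope (H' j) := hae
  refine ⟨k', H', ν, hdisj, hsub, hae', fun j => hA (H' j) (hbd j) (hunit j) (hdist j), ?_⟩
  rw [per_congr_ae K hae']
  exact hB k' H' ν hbd hdisj hplane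

end Summit.Ventures.Crystal3D.Theorems

end
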